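import Summits.AtomisticToContinuum.BoseEinsteinCondensation.Theorems.BECThomsonPrincipleFibreConductanceHealingDefs
import Mathlib.MeasureTheory.Function.L2Space
import HarnessLib

/-!
# Route `BECThomsonPrinciple`, crux `FibreConductance` (stmt-AtomisticToContinuum-9480),
# line `healing-split-kinetic-defect` — stub `stub_thomson`, part I: THE HILBERT-SPACE SET-UP

Helpers for `stub_thomson` (`Theorems/BECThomsonPrincipleFibreConductanceStubThomson.lean`): closure
properties of the test functions `IsTest` (sums, complex multiples, conjugates; continuity, periodicity
and boundedness of their directional derivatives), the dual weight `w = ψ²/W` (positive, continuous,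
bounded, `w·W/ψ² = 1`), the Hilbert space `H = L²(cellN; ℂ³)` (`Lp (EuclideanSpace ℂ (Fin 3)) 2` over
`dX` restricted to the cell; `∫‖F‖² = ‖F‖²_H` in `ℝ≥0∞`), the weighted fibre gradient `√w·∇₀ζ`
(continuous, bounded, in `L²`, additive and homogeneous on test functions), the `ℂ`-subspace of test
functions and the linear map `T : ζ ↦ √w∇₀ζ` into `H` with `‖Tζ‖² = ∫(Σ_l|∂_{0,l}ζ|²)·w` (anchor stub
`th_lintegral_T`). All [folklore] (elementary analysis; the functional analysis is Mathlib's).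
-/

noncomputable section

namespace Summit.AtomisticToContinuum.BoseEinsteinCondensation.Cruxes.FibreConductance.HealingSplitKineticDefect

open MeasureTheory
open scoped ENNReal InnerProductSpace ComplexConjugate
open Literature.MathematicalPhysics.QuantumManyBody.BoseGas
open Summit.AtomisticToContinuum.BoseEinsteinCondensation.Cruxes.FibreConductance.ParsevalShellBootstrap

variable {m : ℕ} {L : ℝ}

/-! ## Test functions: closure properties -/

namespace IsTest

variable {η ζ : Config (m + 1) → ℂ}

/-- Test functions are differentiable. [folklore] -/
theorem differentiable (h : IsTest L η) : Differentiable ℝ η := h.1.differentiable one_ne_zero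

/-- Sums of test functions are test functions. [folklore] -/
theorem add (hη : IsTest L η) (hζ : IsTest L ζ) : IsTest L (η + ζ) :=
  ⟨hη.1.add hζ.1, fun X i l => by simp only [Pi.add_apply, hη.2, hζ.2]⟩

/-- Complex multiples of test functions are test functions. [folklore] -/
theorem smul (c : ℂ) (hη : IsTest L η) : IsTest L (c • η) :=
  ⟨contDiff_const.smul hη.1, fun X i l => by simp only [Pi.smul_apply, hη.2]⟩

/-- `0` is a test function. [folklore] -/
theorem zero : IsTest L (0 : Config (m + 1) → ℂ) :=
  ⟨contDiff_const, fun _ _ _ => rfl⟩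

/-- The complex conjugate of a test function is a test function. [folklore] -/
theorem cconj (hη : IsTest L η) : IsTest L (fun X => (starRingEnd ℂ) (η X)) :=
  ⟨Complex.conjCLE.contDiff.comp hη.1, fun X i l => by simp only [hη.2]⟩

/-- The directional derivatives of a test function are continuous. [folklore] -/
theorem continuous_fderiv_apply (h : IsTest L η) (v : Config (m + 1)) :
    Continuous fun X => fderiv ℝ η X v :=
  (h.1.continuous_fderiv one_ne_zero).clm_apply continuous_const

/-- The directional derivatives of a test function are periodic. [folklore] -/
theorem fderiv_periodic (h : IsTest L η) (v X : Config (m + 1)) (i : Fin (m + 1)) (l : Fin 3) :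
    fderiv ℝ η (X + Pi.single i (EuclideanSpace.single l L)) v = fderiv ℝ η X v := by
  have hf : η = fun Y => η (Y + Pi.single i (EuclideanSpace.single l L)) :=
    funext fun Y => (h.2 Y i l).symm
  conv_rhs => rw [hf, fderiv_comp_add_right]

/-- The directional derivatives of a test function are bounded (continuous and periodic). [folklore] -/
theorem exists_bound_fderiv (hL : 0 < L) (h : IsTest L η) (v : Config (m + 1)) :
    ∃ C : ℝ, ∀ X, ‖fderiv ℝ η X v‖ ≤ C := by
  obtain ⟨_, X₂, hX⟩ := exists_forall_le_and_le_of_periodic hL (h.continuous_fderiv_apply v).norm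
    (fun X i k => by simp only [h.fderiv_periodic v X i k])
  exact ⟨_, fun X => (hX X).2⟩

/-- The derivative of the conjugate is the conjugate of the derivative. [folklore] -/
theorem fderiv_conj_apply (η : Config (m + 1) → ℂ) (X v : Config (m + 1)) :
    fderiv ℝ (fun Y => (starRingEnd ℂ) (η Y)) X v = (starRingEnd ℂ) (fderiv ℝ η X v) := by
  have h : (fun Y => (starRingEnd ℂ) (η Y)) = (Complex.conjCLE : ℂ → ℂ) ∘ η := by
    funext Y; simp
  rw [h, ContinuousLinearEquiv.comp_fderiv]
  simp

end IsTest

/-! ## The weight `w = ψ²/W` -/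

/-- The dual weight `w = ψ²/W` (so that `w · W/ψ² = 1`). [folklore] -/
def th_wt (Φ : PeriodicTrialState (m + 1) L) (X : Config (m + 1)) : ℝ := fibrePsi Φ X ^ 2 / fibreW Φ X

variable {Φ : PeriodicTrialState (m + 1) L}

/-- `w > 0` for a zero-free state. [folklore] -/
theorem th_wt_pos (hL : 0 < L) (hΦ : ∀ X, Φ.ψ X ≠ 0) (X : Config (m + 1)) : 0 < th_wt Φ X :=
  div_pos (pow_pos (fibrePsi_pos hL Φ hΦ X) 2) (fibreW_pos hL Φ hΦ X)

/-- `w` is continuous. [folklore] -/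
theorem continuous_th_wt (hL : 0 < L) (hΦ : ∀ X, Φ.ψ X ≠ 0) : Continuous (th_wt Φ) :=
  ((continuous_fibrePsi hL Φ hΦ).pow 2).div (continuous_fibreW Φ) fun X => (fibreW_pos hL Φ hΦ X).ne'

/-- `w` is bounded above. [folklore] -/
theorem exists_th_wt_le (hL : 0 < L) (hΦ : ∀ X, Φ.ψ X ≠ 0) : ∃ C : ℝ, ∀ X, th_wt Φ X ≤ C := by
  obtain ⟨c, C, hc, -, hψC, hcW, -⟩ := exists_fibre_bounds hL Φ hΦ
  refine ⟨C ^ 2 / c, fun X => ?_⟩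
  have hψ := fibrePsi_pos hL Φ hΦ X
  calc th_wt Φ X ≤ C ^ 2 / fibreW Φ X :=
        div_le_div_of_nonneg_right (pow_le_pow_left₀ hψ.le (hψC X) 2) (fibreW_pos hL Φ hΦ X).le
    _ ≤ C ^ 2 / c := div_le_div_of_nonneg_left (sq_nonneg _) hc (hcW X)

/-- `w · (W/ψ²) = 1`. [folklore] -/
theorem th_wt_mul_weight (hL : 0 < L) (hΦ : ∀ X, Φ.ψ X ≠ 0) (X : Config (m + 1)) (a : ℝ) :
    th_wt Φ X * a * fibreW Φ X / fibrePsi Φ X ^ 2 = a := by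
  unfold th_wt
  field_simp [(fibrePsi_pos hL Φ hΦ X).ne', (fibreW_pos hL Φ hΦ X).ne']

/-! ## The Hilbert space `L²(cellN; ℂ³)` and the weighted fibre gradient -/

/-- The measure `dX` on the fundamental cell. [folklore] -/
abbrev th_mu (m : ℕ) (L : ℝ) : Measure (Config (m + 1)) := volume.restrict (cellN (m + 1) L)

/-- The cell has finite measure. [folklore] -/
theorem th_isFiniteMeasure (m : ℕ) (L : ℝ) : IsFiniteMeasure (th_mu m L) := by
  refine isFiniteMeasure_restrict.2 ?_
  rw [volume_cellN]
  exact ENNReal.pow_ne_top (ENNReal.pow_ne_top ENNReal.ofReal_ne_top)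

/-- The Hilbert space `H = L²(cellN; ℂ³)`. [folklore] -/
abbrev th_H (m : ℕ) (L : ℝ) : Type := Lp (EuclideanSpace ℂ (Fin 3)) 2 (th_mu m L)

/-- `∫ ‖F‖² = ‖F‖²_H` for `F ∈ L²(cellN; ℂ³)`, in `ℝ≥0∞`. [folklore] -/
theorem th_lintegral_norm_sq (F : th_H m L) :
    ∫⁻ X, ENNReal.ofReal (‖F X‖ ^ 2) ∂(th_mu m L) = ENNReal.ofReal (‖F‖ ^ 2) := by
  have hint : Integrable (fun X => ‖F X‖ ^ 2) (th_mu m L) :=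
    (memLp_two_iff_integrable_sq_norm (Lp.aestronglyMeasurable F)).1 (Lp.memLp F)
  rw [← ofReal_integral_eq_lintegral_ofReal hint (ae_of_all _ fun X => sq_nonneg _)]
  congr 1
  rw [← inner_self_eq_norm_sq (𝕜 := ℂ) F, L2.inner_def, ← integral_re (L2.integrable_inner F F)]
  exact integral_congr_ae (ae_of_all _ fun X => (inner_self_eq_norm_sq (𝕜 := ℂ) (F X)).symm)

/-- The weighted fibre gradient `X ↦ √w(X) · ∇₀ζ(X) ∈ ℂ³` of a function `ζ`. [folklore] -/
def th_grad (Φ : PeriodicTrialState (m + 1) L) (ζ : Config (m + 1) → ℂ) (X : Config (m + 1)) :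
    EuclideanSpace ℂ (Fin 3) :=
  WithLp.toLp 2 fun l => (Real.sqrt (th_wt Φ X) : ℂ) * fderiv ℝ ζ X (e0 m l)

/-- Components of the weighted gradient. [folklore] -/
@[simp] theorem th_grad_apply (ζ : Config (m + 1) → ℂ) (X : Config (m + 1)) (l : Fin 3) :
    th_grad Φ ζ X l = (Real.sqrt (th_wt Φ X) : ℂ) * fderiv ℝ ζ X (e0 m l) := rfl

/-- The weighted gradient of a test function is continuous. [folklore] -/
theorem continuous_th_grad (hL : 0 < L) (hΦ : ∀ X, Φ.ψ X ≠ 0) {ζ : Config (m + 1) → ℂ}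
    (hζ : IsTest L ζ) : Continuous (th_grad Φ ζ) := by
  have hs : Continuous fun X => (Real.sqrt (th_wt Φ X) : ℂ) :=
    Complex.continuous_ofReal.comp ((continuous_th_wt hL hΦ).sqrt)
  unfold th_grad
  exact (PiLp.continuous_toLp 2 _).comp
    (continuous_pi fun l => hs.mul (hζ.continuous_fderiv_apply _))

/-- Squared norm of the weighted gradient: `‖√w∇₀ζ‖² = (Σ_l |∂_{0,l}ζ|²)·w`. [folklore] -/
theorem norm_sq_th_grad (hL : 0 < L) (hΦ : ∀ X, Φ.ψ X ≠ 0) (ζ : Config (m + 1) → ℂ)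
    (X : Config (m + 1)) :
    ‖th_grad Φ ζ X‖ ^ 2 = (∑ l : Fin 3, ‖fderiv ℝ ζ X (e0 m l)‖ ^ 2) * th_wt Φ X := by
  rw [PiLp.norm_sq_eq_of_L2, Finset.sum_mul]
  refine Finset.sum_congr rfl fun l _ => ?_
  change ‖(Real.sqrt (th_wt Φ X) : ℂ) * fderiv ℝ ζ X (e0 m l)‖ ^ 2 = _
  rw [norm_mul, mul_pow, Complex.norm_real, Real.norm_eq_abs, sq_abs,
    Real.sq_sqrt (th_wt_pos hL hΦ X).le, mul_comm]

/-- The weighted gradient of a test function is bounded. [folklore] -/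
theorem exists_bound_th_grad (hL : 0 < L) (hΦ : ∀ X, Φ.ψ X ≠ 0) {ζ : Config (m + 1) → ℂ}
    (hζ : IsTest L ζ) : ∃ C : ℝ, ∀ X, ‖th_grad Φ ζ X‖ ≤ C := by
  obtain ⟨Cw, hCw⟩ := exists_th_wt_le hL hΦ (Φ := Φ)
  choose Cl hCl using fun l : Fin 3 => hζ.exists_bound_fderiv hL (e0 m l)
  refine ⟨Real.sqrt ((∑ l : Fin 3, Cl l ^ 2) * Cw), fun X => ?_⟩
  refine (Real.le_sqrt (norm_nonneg _) ?_).2 ?_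
  · exact mul_nonneg (Finset.sum_nonneg fun l _ => sq_nonneg _)
      ((th_wt_pos hL hΦ X).le.trans (hCw X))
  · rw [norm_sq_th_grad hL hΦ]
    refine mul_le_mul ?_ (hCw X) (th_wt_pos hL hΦ X).le (Finset.sum_nonneg fun l _ => sq_nonneg _)
    exact Finset.sum_le_sum fun l _ => pow_le_pow_left₀ (norm_nonneg _) (hCl l X) 2

/-- The weighted gradient of a test function is in `L²(cellN; ℂ³)`. [folklore] -/
theorem memLp_th_grad (hL : 0 < L) (hΦ : ∀ X, Φ.ψ X ≠ 0) {ζ : Config (m + 1) → ℂ}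
    (hζ : IsTest L ζ) : MemLp (th_grad Φ ζ) 2 (th_mu m L) := by
  haveI := th_isFiniteMeasure m L
  obtain ⟨C, hC⟩ := exists_bound_th_grad hL hΦ hζ
  exact MemLp.of_bound (continuous_th_grad hL hΦ hζ).aestronglyMeasurable C
    (Filter.Eventually.of_forall hC)

/-- The weighted gradient is additive on test functions. [folklore] -/
theorem th_grad_add {ζ₁ ζ₂ : Config (m + 1) → ℂ} (h₁ : IsTest L ζ₁) (h₂ : IsTest L ζ₂) :
    th_grad Φ (ζ₁ + ζ₂) = th_grad Φ ζ₁ + th_grad Φ ζ₂ := by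
  funext X
  simp only [Pi.add_apply]
  unfold th_grad
  rw [← WithLp.toLp_add]
  congr 1
  funext l
  rw [fderiv_add (h₁.differentiable X) (h₂.differentiable X)]
  simp only [add_apply, Pi.add_apply, mul_add]

/-- The weighted gradient is homogeneous on test functions. [folklore] -/
theorem th_grad_smul (c : ℂ) {ζ : Config (m + 1) → ℂ} (h : IsTest L ζ) :
    th_grad Φ (c • ζ) = c • th_grad Φ ζ := by
  funext X
  simp only [Pi.smul_apply]
  unfold th_grad
  rw [← WithLp.toLp_smul]
  congr 1
  funext l
  rw [fderiv_const_smul (h.differentiable X) c]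
  show (Real.sqrt (th_wt Φ X) : ℂ) * (c • fderiv ℝ ζ X (e0 m l)) = c • (_ * _)
  simp only [smul_eq_mul]
  ring

/-! ### The space of test functions, the map `T` and the functional `Λ` -/

/-- The `ℂ`-subspace of test functions. [folklore] -/
def th_testSub (m : ℕ) (L : ℝ) : Submodule ℂ (Config (m + 1) → ℂ) where
  carrier := {η | IsTest L η}
  add_mem' := fun h₁ h₂ => IsTest.add h₁ h₂
  zero_mem' := IsTest.zero
  smul_mem' := fun c _ h => IsTest.smul c h

/-- `T : ζ ↦ √w∇₀ζ`, test functions to `L²(cellN; ℂ³)`, as a `ℂ`-linear map. [folklore] -/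
def th_T (hL : 0 < L) (hΦ : ∀ X, Φ.ψ X ≠ 0) : th_testSub m L →ₗ[ℂ] th_H m L where
  toFun ζ := (memLp_th_grad hL hΦ (Φ := Φ) ζ.2).toLp (th_grad Φ ζ)
  map_add' ζ₁ ζ₂ := by
    rw [← MemLp.toLp_add]
    congr 1
    exact th_grad_add ζ₁.2 ζ₂.2
  map_smul' c ζ := by
    rw [RingHom.id_apply, ← MemLp.toLp_const_smul]
    congr 1
    exact th_grad_smul c ζ.2

/-- `Tζ = √w∇₀ζ` almost everywhere. [folklore] -/
theorem th_T_ae (hL : 0 < L) (hΦ : ∀ X, Φ.ψ X ≠ 0) (ζ : th_testSub m L) :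
    (th_T hL hΦ ζ : Config (m + 1) → EuclideanSpace ℂ (Fin 3)) =ᵐ[th_mu m L] th_grad Φ ζ :=
  MemLp.coeFn_toLp (memLp_th_grad hL hΦ ζ.2)

/-- `‖Tζ‖² = ∫ (Σ_l |∂_{0,l}ζ|²)·w`, in `ℝ≥0∞`. [folklore] -/
theorem th_lintegral_T (hL : 0 < L) (hΦ : ∀ X, Φ.ψ X ≠ 0) (ζ : th_testSub m L) :
    ∫⁻ X, ENNReal.ofReal ((∑ l : Fin 3, ‖fderiv ℝ (ζ : Config (m + 1) → ℂ) X (e0 m l)‖ ^ 2) *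
        th_wt Φ X) ∂(th_mu m L) = ENNReal.ofReal (‖th_T hL hΦ ζ‖ ^ 2) := by
  rw [← th_lintegral_norm_sq]
  refine lintegral_congr_ae ((th_T_ae hL hΦ ζ).mono fun X hX => ?_)
  dsimp only
  rw [hX, norm_sq_th_grad hL hΦ]

end Summit.AtomisticToContinuum.BoseEinsteinCondensation.Cruxes.FibreConductance.HealingSplitKineticDefect

end
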